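import Summits.QuantumFields.YangMills.Theorems.BalabanUVNodesK0TopIndexWrapGeometry
import Summits.QuantumFields.YangMills.Theorems.BalabanUVNodesK0ConstantDirectionTower
import Literature.MathematicalPhysics.QuantumFieldTheory.Balaban1983to89.Node00.Record12BgRowCoClassGauge
import Literature.MathematicalPhysics.QuantumFieldTheory.Balaban1983to89.Node00.CriticalOnFibreGauge

/-!
# K0⁶ ROW P11 — THE WRAP WITNESS FOR THE ∃-GAUGE EDITION OF THE [15]-FACT: at the TOP index the constant-direction minimiser admits NO gauge with `‖A‖ < B₃'δ_k` on the
# torus-wrapping [I]-cube (torus holonomy), so the non-wrapping premise of node00-def-P11's v1.1 sentence ∕ dag-n07-e's Δ2 is NECESSARY, and the v1.0 sentence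
# (every cube, no premise) is FALSE for every cube letter `M ≥ 1`

Cell `pub-ymgap`, seat `pub-ymgap-dag-n21-c` g10 (R134 (a) N21 NE7c s1; K0 ROW P11 negative lane of record for the [15]-fact editions; INBOX CENSUS + INTENT-1 l.20027,
dag-lead DEDUP-294 GO; dag-n07-e «YOURS» + RACE WARNING l.≈20044).  Filed `--kind proof --supports stmt-QuantumFields-20506 --as helper` (K0⁶ `Record13SepCoPRInhabited`).
[15] = [Balaban1985Variational], [I] = [Balaban1987RG1], [III] = [Balaban1988Convergent], [6] = [Balaban1985RegularSpaces].

CONTEXT.  node00-def-P11's FILE 14 `Node00/Record12BgRowCoClassGauge.lean` types the K0 road's second [15] sentence as (9) LINE 1 in ∃-gauge form: `Sect2.LocalGaugeOn □ η_n (B₃'δ_n) U₀`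
(a gauge `u` and a potential `A` with `U₀^u = e^{iη_nA}`, `‖A‖ < B₃'δ_n`, `‖∇^{η_n}A‖ < B₃'δ_n`) on the `LⁿM`-cubes ([III] (2.38)) and the `L^{n+1}M`-cubes ([I] (1.12)) inside `Ω_n`.
Its v1.0 (p532745, 13:03Z) asked this of EVERY such grid cube; dag-n07-e LOCATED-Δ2 (INBOX l.19985∕19990): a grid «cube» whose side reaches the period WRAPS the torus, and
then the sentence is refutable through the torus holonomy; v1.1 (p534358, 13:26Z, same names, in place) adds the non-wrapping premise `((side … : ℕ) : ℤ) < sitesPerDir 0`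
per family (dag-n07-e's `Gauge9RegSepTopStep` carries it from the start).  THIS FILE is the kernel certificate of that located point, written so that it names NO version of
the token: the witness is stated against the stable letters `SeqOfRecord` ∕ `Sect2.SeqSeparated` ∕ `Sect2.DataSmall7PTop` ∕ `IsMinimizer` ∕ `Sect2.LocalGaugeOn`, and v1.0's sentence
is refuted BY VALUE (spelled out), so nothing here blocks or reddens under v1.1.

WHAT THIS FILE PROVES (theorems only; no `def`; the geometry — top index, wrapping cube, `SU(N)` root of `−1` — is companion FILE 24B `…K0TopIndexWrapGeometry`).
§3 ★ `dist1_pow_sitesPerDir_le_of_localGaugeOn_univ` — THE TORUS HOLONOMY OBSTRUCTION: if the constant-direction configuration (`D` on the `e_{μ₀}`-bonds, `1` elsewhere;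
companion FILE 24A `…K0ConstantDirectionTower`) carries `Sect2.LocalGaugeOn univ ξ t` (`0 ≤ ξ`, `ξt ≤ 1`), then along the `μ₀`-cycle of `P` bonds the handed-over gauge telescopes,
`u(x₀)·D^P·u(x₀)⁻¹ = ∏ e^{iξA(b_i)}`, each factor within `2ξt` of `1` (`‖e^Y − 1‖ ≤ 2‖Y‖`), so `dist1 (D^P) ≤ P·2ξt` (`dist1_conj`, `dist1_mul_le`); `not_localGaugeOn_univ_of_lt_dist1_pow`.
§4 ★★ `exists_wrap_witness_top` — THE WRAP WITNESS: for every `F`, `N ≥ 2`, selector `Sup`, cube letter `M ≥ 1`, `B₃`, `B₃'`, `0 < a₀`, `0 < a₁`, `K`: at the top index of length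
`k = K + m`, numerics `numerics7OfRecord₁₂` (`M₁ = 1`), constant thresholds `δ′ = min(a₁, a₀∕max(B₃,1), 1∕(8P·max(B₃′,1)))`, `ε₀ = a₀`, the constant-direction `U₀` with its own averaged
tower as datum satisfies EVERY antecedent clause of the ∃-gauge sentence (separation; `0 < M₁`; numerics letters; two-sided comparability; print's (7) on the support — every plaquette
variable read is `1`; minimiser over the top-domain class (6) — FILE 21A `mem_classTop_of_forall_dist1_lt`, action `0`), the [I]-cube of step `n = k` with index `0` is a cube index inside
`Ω_k = T_η`, its non-wrapping premise FAILS, and `Sect2.LocalGaugeOn □ η_k (B₃′δ_k) U₀` FAILS on it (`P·2η_kB₃′δ′ ≤ 1∕4 < 2`).  ★★ `not_gaugeSentence_unguarded`: hence v1.0's sentence,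
written out by value, is false for every `M ≥ 1` (instance `K = 0`, `k = m`).  All averaging levels used satisfy `j + 1 ≤ m + K` (standing range of `Setup`).
REPAIR CLASS (for the record): misstated-by-range; C′ = v1.1 (the witness's only cube wraps, so it misses C′; at node00-def-K0a's `M = 1`, `k ≤ p.K` no cube of either family wraps).
Companion `…K0VariationalThm1GaugeFloors`: the cheap floors `0 < B₃'` ∕ `0 < B₉` of the guarded sentences (v1.1 and dag-n07-e's step sentences).

HONEST FRAMING: a kernel witness about TREE-typed letters (`Prop`-valued named facts with parameters, never asserted); nothing of Bałaban asserted or refuted ([15] (9) ∕ [I] (1.12)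
are stated on class cubes that never wrap); K0⁶ neither discharged nor refuted; N21 NOT discharged; NE7c NOT PRINTED ∕ NOT PROVED; counts unmoved (typed 28∕28 · discharged 5∕28);
one finite `𝕋⁴` torus family at fixed `ε = L^{−K}`; not continuum ∕ OS ∕ mass gap ∕ Clay.  THEOREMS ONLY: no `def`, `instance`, `notation`, `sorry`; standard axioms.
DEPENDENCES (by name, CITED not restated): FILE 24A `K0ConstantDirectionTower.*` (p534751); node00-def-P11 `Sect2.LocalGaugeOn` (FILE 14), `Sect2.DataSmall7PTop ∕ omegaPlaqsTop ∕
CoDivClassOnTop` (12a), `Record12BgRowGaugeAxial.gaugeU_ιSU`; dag-n07-e `CriticalOnFibreGauge.dist1_su_eq_norm`; NODE 00 `SeqOfRecord ∕ DOfRecord ∕ unionsOfCubes ∕ cubeIndices ∕ cubeEnl ∕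
RkOfRecord ∕ numerics7OfRecord₁₂ ∕ avOfRecord ∕ ιSU ∕ coe_ιSU`, r11 `IsMinimizer ∕ AgreeOn ∕ avgFamily ∕ genSet ∕ Seq ∕ Chain21`, `Sect2.SeqSeparated` (FILE 1 v1.1), `B12RegularSpaces111.expI ∕ gaugeU`,
pub-balaban `B7TransferAnalyticMean.norm_exp_sub_one_le_two_mul`, this lineage's FILE 21A `mem_classTop_of_forall_dist1_lt`, FILE 16 `cover_zero_mem_cubeEnl_zero`, FILE 12 `shift_cover`,
Mathlib `Matrix.l2_opNorm_diagonal ∕ Complex.exp_pi_mul_I`, `Setup.wilsonAction4_nonneg`, `GaugeGroup.dist1_conj ∕ dist1_mul_le`.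
-/

noncomputable section

open scoped Matrix.Norms.L2Operator

namespace Summit.QuantumFields.YangMills.Theorems.K0VariationalThm1GaugeWrap

open Literature.MathematicalPhysics.QuantumFieldTheory.Balaban1983to89
open Literature.MathematicalPhysics.QuantumFieldTheory.Balaban1983to89.Node00
open Literature.MathematicalPhysics.QuantumFieldTheory.Balaban1983to89.T4Continuum
open B15Eq112TorusCover B14DomainGeom B15DeterminingSets B15LatticeCubeTorus BlockAveraging B12RegularSpaces111
open Literature.MathematicalPhysics.QuantumFieldTheory.Balaban1983to89.T3DescentFibreTower (avgFun_one expMeanLogSU_E_one)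
open ExpMeanLog (expMeanLogSU)
open Summit.QuantumFields.YangMills.Theorems.K0BgProvisoOverRange (shift_cover)
open Summit.QuantumFields.YangMills.Theorems.K0VariationalThm1ScaledCorner (cover_zero_mem_cubeEnl_zero RkOfRecord_at_one)
open Summit.QuantumFields.YangMills.BalabanUVNodes.N07SmallActionBoundaryAvoidance (wilsonAction4_le_card_mul_sq mixedField_avg_self)
open Summit.QuantumFields.YangMills.Theorems.K0TopClassSmallActionMinimiser (mem_classTop_of_forall_dist1_lt coDivSmallOn_of_forall_dist1_le)
open Summit.QuantumFields.YangMills.Theorems.K0VariationalThm1C1Floor (cover_mem_cubeEnl_zero_of_le_one)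
open Summit.QuantumFields.YangMills.Theorems.K0ConstantDirectionTower

open Summit.QuantumFields.YangMills.Theorems.K0TopIndexWrapGeometry

/-! ## §3  Torus holonomy through a handed-over gauge: `Sect2.LocalGaugeOn univ ξ t U` for a constant-direction `U` bounds `dist1 (D ^ sitesPerDir 0)` -/
section Holonomy

variable {P : Params} {N : ℕ} [NeZero N]

omit [NeZero N] in
/-- `‖e^{iξa} − 1‖ ≤ 2ξ‖a‖` for `0 ≤ ξ` and `ξ‖a‖ ≤ 1` (`‖e^Y − 1‖ ≤ 2‖Y‖` for `‖Y‖ ≤ 1`, `B7TransferAnalyticMean.norm_exp_sub_one_le_two_mul`). [folklore] -/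
theorem norm_expI_sub_one_le {ξ : ℝ} (hξ : 0 ≤ ξ) {a : MatA N} (h : ξ * ‖a‖ ≤ 1) :
    ‖((expI ξ a : (MatA N)ˣ) : MatA N) - 1‖ ≤ 2 * (ξ * ‖a‖) := by
  have hn : ‖(Complex.I * (ξ : ℂ)) • a‖ = ξ * ‖a‖ := by
    rw [norm_smul, norm_mul, Complex.norm_I, one_mul, Complex.norm_real, Real.norm_of_nonneg hξ]
  show ‖NormedSpace.exp ((Complex.I * (ξ : ℂ)) • a) - 1‖ ≤ _
  rw [← hn]
  exact B7TransferAnalyticMean.norm_exp_sub_one_le_two_mul (by rw [hn]; exact h)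

/-- **★ THE TORUS HOLONOMY OBSTRUCTION.**  If a constant-direction configuration (`D` on the `μ₀`-bonds, `1` elsewhere) admits on the WHOLE torus a gauge `u` and a potential `A`
with `U^u = e^{iξA}` and `‖A‖ < t` on every bond (`Sect2.LocalGaugeOn univ ξ t U`, `0 ≤ ξ`, `ξt ≤ 1`), then its holonomy around the `μ₀`-cycle of `P = sitesPerDir 0` bonds through
the origin, `u(x₀)·D^P·u(x₀)⁻¹`, is the ordered product of `P` factors each within `2ξt` of `1`, so `dist1 (D ^ P) ≤ P·2ξt` — a gauge-INVARIANT quantity the handed-over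
gauge cannot move. [cite: Balaban1987RG1, (1.12) p.262 («cubes □ ⊂ X»: print's cubes never wrap); Balaban1985Averaging, (8) p.18 (gauge covariance of transport)] -/
theorem dist1_pow_sitesPerDir_le_of_localGaugeOn_univ (D : SU N) (μ₀ : Fin P.d) {U : GaugeField P 0 (SU N)}
    (hU : ∀ b, U b = if b.dir = μ₀ then D else 1) {ξ t : ℝ} (hξ : 0 ≤ ξ) (hξt : ξ * t ≤ 1)
    (h : Sect2.LocalGaugeOn (Set.univ : Set (Site P 0)) ξ t U) :
    dist1 (D ^ P.sitesPerDir 0) ≤ (P.sitesPerDir 0 : ℝ) * (2 * (ξ * t)) := by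
  obtain ⟨u, A, he, hA, -⟩ := h
  -- the `μ₀`-cycle through the origin: `x_i = i·e_{μ₀}`
  set x : ℕ → Site P 0 := fun i => Function.update (fun _ => (0 : ZMod (P.sitesPerDir 0))) μ₀ (i : ZMod (P.sitesPerDir 0)) with hx
  have hshift : ∀ i, (x i).shift μ₀ = x (i + 1) := fun i => by
    funext ν
    by_cases hν : ν = μ₀
    · subst hν; simp [hx, Site.shift, Nat.cast_succ]
    · simp [hx, Site.shift, Function.update_of_ne hν]
  have hxP : x (P.sitesPerDir 0) = x 0 := by
    simp [hx]
  have hbmem : ∀ i, (⟨x i, μ₀⟩ : PBond P 0) ∈ (Sect2.regionOfSet P (Set.univ : Set (Site P 0))).bonds := fun i =>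
    ⟨Set.mem_univ _, Set.mem_univ _⟩
  -- every factor `u(x_i)·D·u(x_{i+1})⁻¹ = e^{iξA(b_i)}` is within `2ξt` of `1`
  have hV : ∀ i, dist1 (u (x i) * D * (u (x (i + 1)))⁻¹) ≤ 2 * (ξ * t) := by
    intro i
    have h1 := he ⟨x i, μ₀⟩ (hbmem i)
    rw [gaugeU_ιSU] at h1
    have h2 : GaugeField.gaugeAct u U ⟨x i, μ₀⟩ = u (x i) * D * (u (x (i + 1)))⁻¹ := by
      show u (x i) * U ⟨x i, μ₀⟩ * (u ((x i).shift μ₀))⁻¹ = _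
      rw [hU, if_pos rfl, hshift]
    rw [h2] at h1
    rw [dist1_su_eq_norm, ← coe_ιSU, h1]
    have hAi := (hA _ (hbmem i)).le
    have hAt : ξ * ‖A ⟨x i, μ₀⟩‖ ≤ 1 := (mul_le_mul_of_nonneg_left hAi hξ).trans hξt
    exact (norm_expI_sub_one_le hξ hAt).trans (by gcongr)
  -- telescoping along the cycle
  have htel : ∀ n : ℕ, dist1 (u (x 0) * D ^ n * (u (x n))⁻¹) ≤ n * (2 * (ξ * t)) := by
    intro n
    induction n with
    | zero => simp [GaugeGroup.dist1_one]
    | succ n ih =>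
      have hsplit : u (x 0) * D ^ (n + 1) * (u (x (n + 1)))⁻¹ =
          (u (x 0) * D ^ n * (u (x n))⁻¹) * (u (x n) * D * (u (x (n + 1)))⁻¹) := by
        rw [pow_succ]; group
      rw [hsplit]
      calc dist1 ((u (x 0) * D ^ n * (u (x n))⁻¹) * (u (x n) * D * (u (x (n + 1)))⁻¹))
          ≤ dist1 (u (x 0) * D ^ n * (u (x n))⁻¹) + dist1 (u (x n) * D * (u (x (n + 1)))⁻¹) := GaugeGroup.dist1_mul_le _ _
        _ ≤ n * (2 * (ξ * t)) + 2 * (ξ * t) := add_le_add ih (hV n)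
        _ = ((n + 1 : ℕ) : ℝ) * (2 * (ξ * t)) := by push_cast; ring
  have hfin := htel (P.sitesPerDir 0)
  rw [hxP, GaugeGroup.dist1_conj] at hfin
  exact hfin

/-- Hence: a constant-direction configuration whose cycle holonomy `D ^ sitesPerDir 0` is at distance `> P·2ξt` from `1` admits NO such gauge on the whole torus.
[cite: Balaban1987RG1, (1.12) p.262 (bookkeeping)] -/
theorem not_localGaugeOn_univ_of_lt_dist1_pow (D : SU N) (μ₀ : Fin P.d) {U : GaugeField P 0 (SU N)}
    (hU : ∀ b, U b = if b.dir = μ₀ then D else 1) {ξ t : ℝ} (hξ : 0 ≤ ξ) (hξt : ξ * t ≤ 1)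
    (hlt : (P.sitesPerDir 0 : ℝ) * (2 * (ξ * t)) < dist1 (D ^ P.sitesPerDir 0)) :
    ¬ Sect2.LocalGaugeOn (Set.univ : Set (Site P 0)) ξ t U :=
  fun h => absurd (dist1_pow_sitesPerDir_le_of_localGaugeOn_univ D μ₀ hU hξ hξt h) (not_le.mpr hlt)

end Holonomy

/-! ## §4  ★★ THE WRAP WITNESS at the TOP index `k = K + m` (tightness of the non-wrapping letter of the ∃-gauge sentence; the v1.0 sentence refuted by value) -/
section Wrap

variable {F : T4Family} {N : ℕ} [NeZero N]

/-- `0 ≤ η_k ≤ 1`. [cite: Balaban1987RG1, (1.1) p.260 (bookkeeping)] -/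
theorem eta_nonneg_le_one (P : Params) (k : ℕ) : 0 ≤ P.eta k ∧ P.eta k ≤ 1 := by
  have hL : (1 : ℝ) ≤ P.L := by exact_mod_cast P.L_pos
  unfold Params.eta
  exact ⟨by positivity, pow_le_one₀ (by positivity) (inv_le_one_of_one_le₀ hL)⟩

/-- **★★ THE WRAP WITNESS.**  For every torus family `F`, `N ≥ 2`, every top-domain selector `Sup`, every cube letter `M ≥ 1`, every `B₃`, `B₃'`, `0 < a₀`, `0 < a₁` and every `K`:
at the TOP index of length `k = K + m` (`Ω_j = T_η` throughout, separated), numerics `numerics7OfRecord₁₂` (`M₁ = 1`), constant thresholds `δ ≡ δ′ = min(a₁, a₀∕max(B₃,1),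
1∕(8·P·max(B₃′,1)))`, `ε₀ = a₀`, the constant-direction configuration `U₀` (`D` on the `e₀`-bonds, `dist1 (D^P) = 2`, `P = sitesPerDir 0 = 2L^{m+K}`) with ITS OWN averaged tower
as datum `W` satisfies EVERY antecedent clause of node00-def-P11's ∃-gauge sentence (separation, `0 < M₁`, numerics letters, two-sided comparability, `ε₀ ≤ a₀`, print's (7) on the
support — every plaquette variable read is `1` —, minimiser over the top-domain class (6) — all plaquettes `1`, action `0`), the [I]-family cube of step `n = k` with index
`a = 0` is a cube index and lies in `Ω_k = T_η`, BUT it WRAPS (`side L M (k+1) = L^{K+m+1}·M ≥ 2L^{m+K}`: the non-wrapping premise FAILS) and the conclusion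
`Sect2.LocalGaugeOn □ η_k (B₃′δ_k) U₀` FAILS on it (§3: the cube is the torus, `P·2η_kB₃′δ′ ≤ 1∕4 < 2 = dist1 (D^P)`).  Hence (i) FILE 14 v1.0's UNGUARDED sentence
(p532745 :225–241, every cube of both families) is FALSE for every `M ≥ 1` (`not_gaugeSentence_unguarded` below, by value), and (ii) the non-wrapping premise of v1.1 ∕ of
dag-n07-e's `Gauge9RegSepTopStep` (Δ2) is NOT an idle hypothesis.  All averaging levels used (`j + 1 ≤ m + K`) lie in the standing range.
[cite: Balaban1985Variational, (2),(5),(6),(7) p.278, Thm 1 (9) p.279; Balaban1987RG1, (0.1) p.251, (0.4) p.253, (1.12) p.262; Balaban1988Convergent, (2.1) p.254, (2.12) p.256, (2.38) p.261; Balaban1985RegularSpaces, (1.3)–(1.9) p.77] -/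
theorem exists_wrap_witness_top (hN : 2 ≤ N) (Sup : (ν : Stage7Numerics) → (K : ℕ) → (ℕ → Set (Site (F.P K) 0)) → Set (Site (F.P K) 0))
    {M : ℕ} (hM : 1 ≤ M) (B₃ B₃' : ℝ) {a₀ a₁ : ℝ} (ha₀ : 0 < a₀) (ha₁ : 0 < a₁) (K : ℕ) :
    ∃ (ν : Stage7Numerics) (g : ℕ → ℝ) (k : ℕ) (s : SeqOfRecord F ν M g K k) (ε₀ : ℝ) (δ : ℕ → ℝ)
      (W : MSField (F.P K) (SU N)) (U₀ : GaugeField (F.P K) 0 (SU N)),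
      Sect2.SeqSeparated ν.M₁ s ∧ 0 < ν.M₁ ∧ 1 ≤ k ∧
      (∀ n, n ≤ k → 0 < δ n ∧ δ n ≤ a₁ ∧ B₃ * δ n ≤ ε₀) ∧ (∀ n, n < k → δ n ≤ 2 * δ (n + 1)) ∧ (∀ n, n < k → δ (n + 1) ≤ 2 * δ n) ∧ ε₀ ≤ a₀ ∧
      Sect2.DataSmall7PTop (avOfRecord F N K) s.Ω (Sup ν K s.Ω) k δ W ∧
      IsMinimizer (avOfRecord F N K)
          {U | (∀ n, n ≤ k → PlaqSmallOn (Sect2.omegaPlaqsTop s.Ω (Sup ν K s.Ω) n) (ε₀ * (F.P K).eta n ^ 2) U) ∧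
            Sect2.CoDivClassOnTop s.Ω (Sup ν K s.Ω) k ε₀ U} (genSet s.Ω k) W U₀ ∧
      (0 : Pt (F.P K).d) ∈ cubeIndices (F.P K) (B14.Eq213MaximalDomains.side (F.P K).L M (k + 1)) ∧
      cubeEnl (F.P K) (B14.Eq213MaximalDomains.side (F.P K).L M (k + 1)) 0 0 ⊆ s.Ω k ∧
      ¬ (((B14.Eq213MaximalDomains.side (F.P K).L M (k + 1) : ℕ) : ℤ) < (F.P K).sitesPerDir 0) ∧
      ¬ Sect2.LocalGaugeOn (cubeEnl (F.P K) (B14.Eq213MaximalDomains.side (F.P K).L M (k + 1)) 0 0) ((F.P K).eta k) (B₃' * δ k) U₀ := by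
  classical
  set P : Params := F.P K with hPdef
  have hPd : P.d = 4 := T4Family.P_d F K
  have hd1 : 1 ≤ P.d := by rw [hPd]; norm_num
  have hdpos : (0 : ℝ) < P.d := by rw [hPd]; norm_num
  -- the period and the root of `−1`
  have hPer : 0 < P.sitesPerDir 0 := Nat.pos_of_ne_zero (P.sitesPerDir_ne_zero 0)
  have hPerR : (0 : ℝ) < P.sitesPerDir 0 := by exact_mod_cast hPer
  obtain ⟨D, hD⟩ := exists_su_pow_dist1_eq_two (N := N) hN hPer
  set μ₀ : Fin P.d := ⟨0, by rw [hPd]; norm_num⟩ with hμ₀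
  set U₀ : GaugeField P 0 (SU N) := fun b => if b.dir = μ₀ then D else 1 with hU₀
  have hU : ∀ b, U₀ b = if b.dir = μ₀ then D else 1 := fun _ => rfl
  -- the index: top sequence of length `k = K + m`
  set k : ℕ := K + F.m with hk
  have hk1 : 1 ≤ k := by have := F.hm; omega
  obtain ⟨s, hΩ, hsep⟩ := exists_seq_top F numerics7OfRecord₁₂ hM (fun _ => (1 : ℝ)) K k
  -- thresholds
  obtain ⟨β, hβ⟩ : ∃ β : ℝ, β = max B₃ 1 := ⟨_, rfl⟩
  have hβ1 : 1 ≤ β := by rw [hβ]; exact le_max_right _ _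
  have hβpos : 0 < β := by linarith only [hβ1]
  have hβB : B₃ ≤ β := by rw [hβ]; exact le_max_left _ _
  obtain ⟨β', hβ'⟩ : ∃ β' : ℝ, β' = max B₃' 1 := ⟨_, rfl⟩
  have hβ'1 : 1 ≤ β' := by rw [hβ']; exact le_max_right _ _
  have hβ'pos : 0 < β' := by linarith only [hβ'1]
  have hβ'B : B₃' ≤ β' := by rw [hβ']; exact le_max_left _ _
  obtain ⟨δ', hδ'⟩ : ∃ δ' : ℝ, δ' = min (min a₁ (a₀ / β)) (1 / (8 * P.sitesPerDir 0 * β')) := ⟨_, rfl⟩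
  have hδ'pos : 0 < δ' := by rw [hδ']; exact lt_min (lt_min ha₁ (by positivity)) (by positivity)
  have hδ'a₁ : δ' ≤ a₁ := by rw [hδ']; exact (min_le_left _ _).trans (min_le_left _ _)
  have hδ'β : δ' ≤ a₀ / β := by rw [hδ']; exact (min_le_left _ _).trans (min_le_right _ _)
  have hδ'P : δ' ≤ 1 / (8 * P.sitesPerDir 0 * β') := by rw [hδ']; exact min_le_right _ _
  have hBδ' : B₃ * δ' ≤ a₀ := by
    calc B₃ * δ' ≤ β * δ' := mul_le_mul_of_nonneg_right hβB hδ'pos.le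
      _ ≤ β * (a₀ / β) := mul_le_mul_of_nonneg_left hδ'β hβpos.le
      _ = a₀ := by field_simp
  set δ : ℕ → ℝ := fun _ => δ' with hδdef
  -- datum = the averaged tower of `U₀` itself
  set W : MSField P (SU N) := avgFamily (avOfRecord F N K) U₀ with hW
  have h7 : Sect2.DataSmall7PTop (avOfRecord F N K) s.Ω (Sup numerics7OfRecord₁₂ K s.Ω) k δ W :=
    ⟨fun q _ => by
      show dist1 (GaugeField.plaqHol (avgFamily (avOfRecord F N K) U₀ 0) q) < δ'
      rw [dist1_plaqHol_avgFamily_constDir K D μ₀ hU 0 q]; exact hδ'pos,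
     fun m _ q _ => by
      show dist1 (GaugeField.plaqHol (Sect2.mixedField (avOfRecord F N K) (genSet s.Ω k (m + 1))
        (avgFamily (avOfRecord F N K) U₀ (m + 1)) (avgFamily (avOfRecord F N K) U₀ m)) q) < δ'
      rw [dist1_plaqHol_mixedField_avgFamily_constDir K D μ₀ hU]; exact hδ'pos⟩
  -- class membership and minimality (all plaquettes `1`, action `0`)
  obtain ⟨r, hr⟩ : ∃ r : ℝ, r = a₀ * P.eta k ^ 3 / (4 * P.d) := ⟨_, rfl⟩
  have hηpos : 0 < P.eta k := by unfold Params.eta; have := P.L_pos; positivity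
  have hrpos : 0 < r := by rw [hr]; positivity
  have hrη : (P.d : ℝ) * (2 * r) < a₀ * P.eta k ^ 3 := by
    rw [hr]
    have hpos : 0 < a₀ * P.eta k ^ 3 := by positivity
    have heq : (P.d : ℝ) * (2 * (a₀ * P.eta k ^ 3 / (4 * P.d))) = a₀ * P.eta k ^ 3 / 2 := by
      field_simp; ring
    rw [heq]; linarith only [hpos]
  have hclass := mem_classTop_of_forall_dist1_lt (N := N) hd1 s.Ω (Sup numerics7OfRecord₁₂ K s.Ω) k hrpos.le hrη (U := U₀)
    (fun q => by rw [dist1_plaqHol_constDir D μ₀ hU]; exact hrpos)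
  have hA : AgreeOn (genSet s.Ω k) (avgFamily (avOfRecord F N K) U₀) W := fun _ _ _ => rfl
  have hmin : IsMinimizer (avOfRecord F N K)
      {U | (∀ n, n ≤ k → PlaqSmallOn (Sect2.omegaPlaqsTop s.Ω (Sup numerics7OfRecord₁₂ K s.Ω) n) (a₀ * P.eta n ^ 2) U) ∧
        Sect2.CoDivClassOnTop s.Ω (Sup numerics7OfRecord₁₂ K s.Ω) k a₀ U} (genSet s.Ω k) W U₀ :=
    ⟨hclass, hA, fun U _ _ => (wilsonAction4_constDir_le D μ₀ hU).trans (wilsonAction4_nonneg U)⟩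
  -- the wrapping I-cube of step `k`
  have hside : P.sitesPerDir 0 ≤ B14.Eq213MaximalDomains.side P.L M (k + 1) := sitesPerDir_le_side F K hM
  have hside0 : 0 < B14.Eq213MaximalDomains.side P.L M (k + 1) := lt_of_lt_of_le hPer hside
  have hcube : cubeEnl P (B14.Eq213MaximalDomains.side P.L M (k + 1)) 0 0 = Set.univ := cubeEnl_zero_eq_univ_of_le hside
  -- the holonomy numerics: `P·2·η_k·B₃'·δ' ≤ 1∕4 < 2`
  obtain ⟨hη0, hη1⟩ := eta_nonneg_le_one P k
  have hup : P.eta k * (B₃' * δ') ≤ β' * δ' := by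
    rcases le_or_gt B₃' 0 with hB | hB
    · have h1 : P.eta k * (B₃' * δ') ≤ 0 := mul_nonpos_of_nonneg_of_nonpos hη0 (mul_nonpos_of_nonpos_of_nonneg hB hδ'pos.le)
      linarith [mul_pos hβ'pos hδ'pos]
    · calc P.eta k * (B₃' * δ') ≤ 1 * (B₃' * δ') := mul_le_mul_of_nonneg_right hη1 (by positivity)
        _ ≤ β' * δ' := by rw [one_mul]; exact mul_le_mul_of_nonneg_right hβ'B hδ'pos.le
  have hβ'δ' : β' * δ' ≤ 1 / (8 * P.sitesPerDir 0) := by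
    calc β' * δ' ≤ β' * (1 / (8 * P.sitesPerDir 0 * β')) := mul_le_mul_of_nonneg_left hδ'P hβ'pos.le
      _ = 1 / (8 * P.sitesPerDir 0) := by field_simp
  have hξt : P.eta k * (B₃' * δ') ≤ 1 := by
    have : 1 / (8 * (P.sitesPerDir 0 : ℝ)) ≤ 1 := by
      rw [div_le_one (by positivity)]
      have : (1 : ℝ) ≤ P.sitesPerDir 0 := by exact_mod_cast hPer
      linarith
    linarith
  have hlt : (P.sitesPerDir 0 : ℝ) * (2 * (P.eta k * (B₃' * δ'))) < dist1 (D ^ P.sitesPerDir 0) := by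
    rw [hD]
    have h1 : (P.sitesPerDir 0 : ℝ) * (2 * (P.eta k * (B₃' * δ'))) ≤ (P.sitesPerDir 0 : ℝ) * (2 * (1 / (8 * P.sitesPerDir 0))) :=
      mul_le_mul_of_nonneg_left (by linarith) hPerR.le
    have h2 : (P.sitesPerDir 0 : ℝ) * (2 * (1 / (8 * P.sitesPerDir 0))) = 1 / 4 := by field_simp; ring
    linarith
  refine ⟨numerics7OfRecord₁₂, fun _ => 1, k, s, a₀, δ, W, U₀, hsep, by change (0 : ℕ) < 1; exact Nat.one_pos, hk1,
    fun n _ => ⟨hδ'pos, hδ'a₁, hBδ'⟩, fun n _ => by show δ' ≤ 2 * δ'; linarith only [hδ'pos],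
    fun n _ => by show δ' ≤ 2 * δ'; linarith only [hδ'pos], le_rfl, h7, hmin, zero_mem_cubeIndices hside0, ?_, ?_, ?_⟩
  · rw [hΩ k hk1 le_rfl]; exact Set.subset_univ _
  · exact not_lt.mpr (by exact_mod_cast hside)
  · rw [hcube]
    exact not_localGaugeOn_univ_of_lt_dist1_pow D μ₀ hU hη0 hξt hlt

/-- **★★ FILE 14 v1.0's UNGUARDED ∃-GAUGE SENTENCE IS FALSE FOR EVERY CUBE LETTER `M ≥ 1`** (`N ≥ 2`, `0 < a₀`, `0 < a₁`, every `B₃`, `B₃'`, every `Sup`).  The sentence below is node00-def-P11's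
`VariationalThm1GaugeRegSepTop7M F N Sup M B₃ B₃' a₀ a₁` AS FIRST LANDED (p532745 :225–241, 2026-08-27 13:03Z) written out BY VALUE — its v1.1 (AMEND-14, INBOX l.20023) replaces it
in place under the same name with the non-wrapping premise `((side … : ℕ) : ℤ) < sitesPerDir 0` added to each cube family (dag-n07-e's Δ2), which the witness of
`exists_wrap_witness_top` does not meet; so this theorem records WHY that premise is there and is not a statement about the v1.1 token.  REPAIR CLASS: misstated-by-range
(C′ = v1.1); nothing of Bałaban refuted — print's (9) is stated on class cubes that never wrap.
[cite: Balaban1985Variational, Thm 1 (9) p.279; Balaban1987RG1, (1.12) p.262; Balaban1988Convergent, (2.38) p.261] -/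
theorem not_gaugeSentence_unguarded (hN : 2 ≤ N) (Sup : (ν : Stage7Numerics) → (K : ℕ) → (ℕ → Set (Site (F.P K) 0)) → Set (Site (F.P K) 0))
    {M : ℕ} (hM : 1 ≤ M) (B₃ B₃' : ℝ) {a₀ a₁ : ℝ} (ha₀ : 0 < a₀) (ha₁ : 0 < a₁) :
    ¬ (∀ (ν : Stage7Numerics) (g : ℕ → ℝ) (K k : ℕ) (s : SeqOfRecord F ν M g K k), Sect2.SeqSeparated ν.M₁ s → 0 < ν.M₁ → ∀ (ε₀ : ℝ) (δ : ℕ → ℝ),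
      (∀ n, n ≤ k → 0 < δ n ∧ δ n ≤ a₁ ∧ B₃ * δ n ≤ ε₀) → (∀ n, n < k → δ n ≤ 2 * δ (n + 1)) → (∀ n, n < k → δ (n + 1) ≤ 2 * δ n) → ε₀ ≤ a₀ →
      ∀ W : MSField (F.P K) (SU N), Sect2.DataSmall7PTop (avOfRecord F N K) s.Ω (Sup ν K s.Ω) k δ W →
        ∀ U₀, IsMinimizer (avOfRecord F N K)
            {U | (∀ n, n ≤ k → PlaqSmallOn (Sect2.omegaPlaqsTop s.Ω (Sup ν K s.Ω) n) (ε₀ * (F.P K).eta n ^ 2) U) ∧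
              Sect2.CoDivClassOnTop s.Ω (Sup ν K s.Ω) k ε₀ U} (genSet s.Ω k) W U₀ →
          ∀ n, 1 ≤ n → n ≤ k →
            (∀ a ∈ cubeIndices (F.P K) (B14.Eq213MaximalDomains.side (F.P K).L M n),
                cubeEnl (F.P K) (B14.Eq213MaximalDomains.side (F.P K).L M n) a 0 ⊆ s.Ω n →
                Sect2.LocalGaugeOn (cubeEnl (F.P K) (B14.Eq213MaximalDomains.side (F.P K).L M n) a 0) ((F.P K).eta n) (B₃' * δ n) U₀) ∧
            ∀ a ∈ cubeIndices (F.P K) (B14.Eq213MaximalDomains.side (F.P K).L M (n + 1)),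
                cubeEnl (F.P K) (B14.Eq213MaximalDomains.side (F.P K).L M (n + 1)) a 0 ⊆ s.Ω n →
                Sect2.LocalGaugeOn (cubeEnl (F.P K) (B14.Eq213MaximalDomains.side (F.P K).L M (n + 1)) a 0) ((F.P K).eta n) (B₃' * δ n) U₀) := by
  intro h
  obtain ⟨ν, g, k, s, ε₀, δ, W, U₀, hsep, hM₁, hk1, hδ, hc, hc', hε, h7, hmin, ha, hΩ, -, hnot⟩ :=
    exists_wrap_witness_top (F := F) hN Sup hM B₃ B₃' ha₀ ha₁ 0
  exact hnot ((h ν g 0 k s hsep hM₁ ε₀ δ hδ hc hc' hε W h7 U₀ hmin k hk1 le_rfl).2 0 ha hΩ)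

end Wrap

end Summit.QuantumFields.YangMills.Theorems.K0VariationalThm1GaugeWrap

end
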